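import Literature.AnabelianGeometry.EtaleTheta.SettingModelChiThetaDoubleUnderline
import Literature.AnabelianGeometry.EtaleTheta.SettingModelChiDeltaTheta
import Literature.AnabelianGeometry.EtaleTheta.SettingModelChiTwistedSections
import Literature.AnabelianGeometry.EtaleTheta.SettingModelChiTate2
import Literature.AnabelianGeometry.EtaleTheta.EtaleThetaDataOfClass
import Literature.AnabelianGeometry.EtaleTheta.ContH1Injectivity
import HarnessLib

/-!
# The χ-twisted root model of [EtTh] §1: the étale theta class OF THE MODEL as an explicit continuous cocycle,
# and the choice `X̲̲` for the resulting étale-theta datum (R78 cluster, hand #2″)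

Mochizuki, *The étale theta function …*, Publ. RIMS **45** (2009) [EtTh], §1, Prop. 1.3 pp. 19–21 ("the [étale
theta] class `η^Θ`", "`η̈^Θ ∈ H¹(Π^tp_Ÿ, Δ_Θ)`"; its restriction to the geometric part "is the natural isomorphism"),
§2 Def. 2.7 p. 41 ("upon restriction to the covering `Ÿ̲̲ → Ÿ` … the class `η̈^Θ` determines a class
`η̲̈^Θ ∈ H¹(Π^tp_Ÿ̲̲, l·Δ_Θ)`") [cite: MochizukiEtTh2009, Prop 1.3 p.20].  abc-iut cell, layer L2, prover abc-iut-L2-d1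
(gen 5), R78 cluster hand #2″ (abc-iut-L2-lead gen 3 booking 09:41Z) over abc-iut-L2-t1's record `ThetaSetting.modelχ`
(F5b), abc-iut-L6-d6's `Ẑ`-coordinate `cThetaχ` / `toTheta_eq_of_right_eq_one` (`SettingModelChiDeltaTheta`),
abc-iut-w5-d029's / abc-iut-L2-t6's `b`-axis `bPowGfp`, `levelHom_bPowGfp` (`SettingModelCuspAxis`,
`SettingModelChiTwistedSections`), abc-iut-w5-d171's `eHatB` / `hHat_y_eq_modN_eHatB` / `eHatB_twist` / `kummerDataχ` and
the instance keys at `modelχ` (`SettingModelChiKummerData`), abc-iut-w5-d051's `conj_inl_eq` (`SettingModelChiTate2`),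
abc-iut-L2-t6's `KummerData.etaleThetaDataOfClass` (F7a),
and this seat's `Huuχ` / `doubleUnderlineχOfEtaRes` (hand #2′).

In the model `Π^tp_Y = Ker pr₂ ⋊_χ G_{ℚ_p}`; an element `γ ∈ Ker pr₂ ≤ Γ = F̂₂ ×_Ẑ ℤ` has level coordinates
`ĥ_N(pr₁ γ) = (0, y_N, z_N)`, on which the Heisenberg law is ADDITIVE.  THIS FILE constructs
* `centreRep γ := γ · (b^{ê_b(pr₁ γ)})⁻¹` — "`γ · b^{−ŷ(γ)}`", the projection of `Ker pr₂` onto the centre direction,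
  with levels `(0, 0, z_N(γ))` (`levelHom_centreRep`) and `θ_σ`-equivariant (`actχ_centreRep`);
* **`thetaCocycleFunχ : Π^tp_Y → Δ_Θ`, `g ↦ toTheta (inl (centreRep g.left))`** — continuous
  (`continuous_thetaCocycleFunχ`) and a 1-COCYCLE for the conjugation action through `Π^tp_X ↠ (Π^tp_X)^Θ`
  (`thetaCocycleFunχ_mul`: `z(γ₁·θ_σγ₂) = z(γ₁) + χ(σ)·z(γ₂)`, the Galois part acting on `Δ_Θ ≅ Ẑ(χ)` through `χ` and
  the geometric part trivially — abc-iut-L2-d1's `CurveTheta.ker_thetaToEll_central`); packaged as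
  `thetaCocycleχ ∈ contCocycles`;
* `thetaCocycleFunχ_eq_of_mem_ellKer` — **on the `Δ_Θ`-part the cocycle is the identity** (Prop. 1.3: the restriction of
  `η^Θ` to the geometric part "is the natural isomorphism" `Δ_Θ ⊗ ℤ/N`, here with `e = 1`);
* the classes **`etaχ ∈ H¹(Π^tp_Y, Δ_Θ)`**, **`etaDdχ ∈ H¹(Π^tp_Ÿ, Δ_Θ)`** and `etaDdχ_ne_one` (an HONEST, non-trivial
  class: a coboundary vanishes on the centre, the cocycle does not);
* `thetaCocycleFunχ_mem_lDeltaTheta_of_mem_Huuχ` — on `Π^tp_Ÿ ∩ Π^tp_X̲̲` (`X̲̲ := Huuχ p l`: `z ≡ 0 (mod l)`) the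
  cocycle is `l·Δ_Θ`-valued (`centreRep γ ∈ dUU l`, then hand #2′'s `map_toTheta_Huuχ_modelχ`);
* **`doubleUnderlineχ (l) (hl : Odd l) : ((kummerDataχ p).etaleThetaDataOfClass (etaDdχ p)).DoubleUnderline l`** —
  abc-iut-L2-t8's INPUT N3 (the choice `X̲̲` of Def. 2.5 (i) / Def. 2.7 with ALL six printed properties incl. `eta_res`)
  INHABITED at the χ-model for the étale-theta datum carrying the model's own theta class.
SEMI-SYNTHETIC MODEL (the theta class of the MODEL, not the Kummer class of a theta function); consistency evidence
only; nothing of [EtTh] asserted; no side taken on [IUTchIII] Cor. 3.12.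
-/

noncomputable section

namespace Literature.AnabelianGeometry.EtaleTheta.SettingModel

open Literature.AnabelianGeometry.SemiGraphs _root_.Function
open scoped commutatorElement

variable (p : ℕ) [Fact p.Prime]

/-! ### `γ ↦ γ · b^{−ŷ(γ)}` on `Γ` -/

variable {p} in
/-- **`centreRep γ := γ · (b^{ê_b(pr₁ γ)})⁻¹`** — for `γ ∈ Ker pr₂` (levels `(0, y, z)`) the element `γ·b^{−y}` of levels
`(0, 0, z)`: the centre component of `γ` read in `Γ`. [cite: MochizukiEtTh2009, Prop 1.3 p.20] -/
def centreRep (γ : Gfp) : Gfp := γ * (bPowGfp (eHatB (gfpFst γ)))⁻¹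

variable {p} in
/-- `centreRep` is continuous. [cite: MochizukiEtTh2009, Prop 1.3 p.20] -/
theorem continuous_centreRep : Continuous centreRep :=
  continuous_id.mul (bPowGfp.continuous.comp (eHatB.continuous.comp gfpFst.continuous)).inv

variable {p} in
/-- `pr₂ (centreRep γ) = pr₂ γ` (`b^t` has degree `0`). [cite: MochizukiEtTh2009, Prop 1.3 p.20] -/
theorem gfpSnd_centreRep (γ : Gfp) : gfpSnd (centreRep γ) = gfpSnd γ := by
  rw [centreRep, map_mul, map_inv, gfpSnd_bPowGfp, inv_one, mul_one]

variable {p} in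
/-- The `y`-level of `ĥ_N(pr₁ γ)` is the level of `ê_b(pr₁ γ)`. [cite: MochizukiEtTh2009, §1 p.13] -/
theorem levelHom_y_eq_toAdd_level (N : ℕ+) (γ : Gfp) :
    (levelHom N γ).y = Multiplicative.toAdd (ZHatLevel.level N (eHatB (gfpFst γ))) := by
  rw [← modN_eq_level, ← hHat_y_eq_modN_eHatB, toAdd_ofAdd]
  rfl

variable {p} in
/-- **Levels of `centreRep`**: for `γ ∈ Ker pr₂`, `ĥ_N(pr₁ (γ·b^{−y})) = (0, 0, z_N(γ))`. [cite: MochizukiEtTh2009, Prop 1.3 p.20] -/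
theorem levelHom_centreRep (N : ℕ+) {γ : Gfp} (hγ : γ ∈ gfpSnd.ker) :
    levelHom N (centreRep γ) = ⟨0, 0, (levelHom N γ).z⟩ := by
  have hx : (levelHom N γ).x = 0 := levelHom_x_eq_zero hγ
  rw [centreRep, map_mul, map_inv, levelHom_bPowGfp, ← levelHom_y_eq_toAdd_level]
  ext <;> simp [hx]

variable {p} in
/-- `centreRep γ ∈ Ker pr₂` for `γ ∈ Ker pr₂`. [cite: MochizukiEtTh2009, Prop 1.3 p.20] -/
theorem centreRep_mem_ker {γ : Gfp} (hγ : γ ∈ gfpSnd.ker) : centreRep γ ∈ gfpSnd.ker := by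
  rw [MonoidHom.mem_ker, gfpSnd_centreRep]
  exact hγ

/-- **`centreRep` is `θ_σ`-equivariant**: `θ_{χσ}(γ·b^{−ŷ(γ)}) = θ_{χσ}(γ)·b^{−ŷ(θ_{χσ} γ)}` (`ê_b ∘ θ_φ = φ ∘ ê_b`,
`θ_φ(b^t) = b^{φ t}`). [cite: MochizukiEtTh2009, Prop 1.3 p.20] -/
theorem actχ_centreRep (σ : GQp p) (γ : Gfp) : actχ p σ (centreRep γ) = centreRep (actχ p σ γ) := by
  rw [centreRep, centreRep, map_mul, map_inv, gfpFst_actχ, actHatχ_apply, eHatB_twist, actχ_apply, actχ_apply,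
    twistGfp_bPowGfp]

/-! ### The theta cocycle `Π^tp_Y → Δ_Θ` -/

variable {p} in
/-- Membership in `Π^tp_Y` of the χ-model: degree `0`. [cite: MochizukiEtTh2009, §1 p.12] -/
theorem left_mem_ker_of_mem_GtpY {g : PiTpχ p} (hg : g ∈ (ThetaSetting.modelχ p).GtpY) : g.left ∈ gfpSnd.ker := by
  have h : (chiTwistData p).toZ g = 1 := hg
  rwa [GfpTwistData.toZ_apply] at h

/-- `toTheta (inl (γ·b^{−y})) ∈ Δ_Θ` for `γ ∈ Ker pr₂` (levels `(0, 0, z)`). [cite: MochizukiEtTh2009, Prop 1.3 p.20] -/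
theorem toTheta_inl_centreRep_mem_ker {γ : Gfp} (hγ : γ ∈ gfpSnd.ker) :
    CurveTheta.toTheta (curveχ p) (SemidirectProduct.inl (centreRep γ)) ∈
      (CurveTheta.thetaToEll (curveχ p)).ker := by
  rw [CurveTheta.mk_mem_ker_thetaToEll_iff, mem_ellKerχ_iff, SemidirectProduct.left_inl, SemidirectProduct.right_inl]
  refine ⟨fun N => ?_, rfl⟩
  change (levelHom N (centreRep γ)).x = 0 ∧ (levelHom N (centreRep γ)).y = 0
  rw [levelHom_centreRep N hγ]
  exact ⟨rfl, rfl⟩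

/-- **The étale theta cocycle of the χ-model** on `Π^tp_Y`: `g = (γ, σ) ↦ toTheta (inl (γ·b^{−ŷ(γ)})) ∈ Δ_Θ`.
[cite: MochizukiEtTh2009, Prop 1.3 p.20] -/
def thetaCocycleFunχ (g : ↥(ThetaSetting.modelχ p).GtpY) : ↥(ThetaSetting.modelχ p).DeltaTheta :=
  ⟨CurveTheta.toTheta (curveχ p) (SemidirectProduct.inl (centreRep (g : PiTpχ p).left)),
    toTheta_inl_centreRep_mem_ker p (left_mem_ker_of_mem_GtpY g.2)⟩

/-- [cite: MochizukiEtTh2009, Prop 1.3 p.20] -/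
theorem coe_thetaCocycleFunχ (g : ↥(ThetaSetting.modelχ p).GtpY) :
    ((thetaCocycleFunχ p g : ↥(ThetaSetting.modelχ p).DeltaTheta) : CurveTheta.GTheta (curveχ p)) =
      CurveTheta.toTheta (curveχ p) (SemidirectProduct.inl (centreRep (g : PiTpχ p).left)) := rfl

/-- The theta cocycle is continuous. [cite: MochizukiEtTh2009, Prop 1.3 p.20] -/
theorem continuous_thetaCocycleFunχ : Continuous (thetaCocycleFunχ p) := by
  refine Continuous.subtype_mk ?_ _
  exact (CurveTheta.continuous_toTheta (curveχ p)).comp ((continuous_inlχ p).comp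
    (continuous_centreRep.comp ((Semidirect.continuous_left (isInducing_leftRightχ p)).comp continuous_subtype_val)))

/-- The levels of a representative of the value: `ĥ_N(pr₁ (centreRep γ)) = (0, 0, z_N(γ))`, restated on `Π^tp_Y`.
[cite: MochizukiEtTh2009, Prop 1.3 p.20] -/
theorem hHat_gfpFst_centreRep (N : ℕ+) (g : ↥(ThetaSetting.modelχ p).GtpY) :
    hHat N (gfpFst (centreRep (g : PiTpχ p).left)) = ⟨0, 0, (levelHom N (g : PiTpχ p).left).z⟩ :=
  levelHom_centreRep N (left_mem_ker_of_mem_GtpY g.2)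

/-- **Conjugation through `Π^tp_X ↠ (Π^tp_X)^Θ` acts on the cocycle's values by the twist**: for `g ∈ Π^tp_X` and
`γ ∈ Ker pr₂`, `toTheta g · toTheta (inl (centreRep γ)) · (toTheta g)⁻¹ = toTheta (inl (centreRep (θ_{g.right} γ)))` — the
geometric part `g.left` acts trivially on the centre (`Δ_Θ` central in `(Δ^tp_X)^Θ`), the Galois part through `χ`.
[cite: MochizukiEtTh2009, §1 p.12] -/
theorem conj_toTheta_inl_centreRep (g : PiTpχ p) {γ : Gfp} (hγ : γ ∈ gfpSnd.ker) :
    CurveTheta.toTheta (curveχ p) g * CurveTheta.toTheta (curveχ p) (SemidirectProduct.inl (centreRep γ)) *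
        (CurveTheta.toTheta (curveχ p) g)⁻¹ =
      CurveTheta.toTheta (curveχ p) (SemidirectProduct.inl (centreRep (actχ p g.right γ))) := by
  rw [← map_mul, ← map_inv, ← map_mul, conj_inl_eq p, actχ_centreRep]
  simp only [map_mul, map_inv]
  -- `toTheta (inl g.left)` commutes with the central element `toTheta (inl (centreRep (θ γ)))`
  have hc : CurveTheta.toTheta (curveχ p) (SemidirectProduct.inl (centreRep (actχ p g.right γ))) ∈
      (CurveTheta.thetaToEll (curveχ p)).ker :=
    toTheta_inl_centreRep_mem_ker p (by rw [MonoidHom.mem_ker, (chiTwistData p).hdeg]; exact hγ)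
  have hd : CurveTheta.toTheta (curveχ p) (SemidirectProduct.inl g.left) ∈
      ((curveχ p).aug.toMonoidHom.ker).map (CurveTheta.toTheta (curveχ p)) :=
    ⟨SemidirectProduct.inl g.left, inl_mem_deltaTempχ p g.left, rfl⟩
  rw [← CurveTheta.ker_thetaToEll_central (curveχ p) _ hc _ hd, mul_assoc, mul_inv_cancel, mul_one]

/-- **The cocycle identity** `f(g·h) = f(g) · (toTheta g · f(h) · (toTheta g)⁻¹)` on `Π^tp_Y`: in level coordinates
`z(γ_g · θ_{σ_g} γ_h) = z(γ_g) + χ_N(σ_g)·z(γ_h)` (the `x`-coordinates vanish on `Π^tp_Y`).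
[cite: MochizukiEtTh2009, Prop 1.3 p.20] -/
theorem thetaCocycleFunχ_mul (g h : ↥(ThetaSetting.modelχ p).GtpY) :
    thetaCocycleFunχ p (g * h) =
      thetaCocycleFunχ p g * MulAut.conjNormal ((ThetaSetting.modelχ p).toTheta (g : PiTpχ p)) (thetaCocycleFunχ p h) := by
  have hg := left_mem_ker_of_mem_GtpY g.2
  have hh := left_mem_ker_of_mem_GtpY h.2
  have hθh : actχ p (g : PiTpχ p).right (h : PiTpχ p).left ∈ gfpSnd.ker := by
    rw [MonoidHom.mem_ker, (chiTwistData p).hdeg]; exact hh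
  have hA : ((g : PiTpχ p) * (h : PiTpχ p)).left ∈ gfpSnd.ker := left_mem_ker_of_mem_GtpY (g * h).2
  apply Subtype.ext
  rw [Subgroup.coe_mul, MulAut.conjNormal_apply, coe_thetaCocycleFunχ, coe_thetaCocycleFunχ, coe_thetaCocycleFunχ]
  change CurveTheta.toTheta (curveχ p) (SemidirectProduct.inl (centreRep (((g : PiTpχ p) * (h : PiTpχ p)).left))) =
    _ * (CurveTheta.toTheta (curveχ p) (g : PiTpχ p) * _ * (CurveTheta.toTheta (curveχ p) (g : PiTpχ p))⁻¹)
  rw [conj_toTheta_inl_centreRep p _ hh, ← map_mul, ← map_mul]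
  -- both sides are `toTheta` of elements with trivial Galois component: compare levels
  refine toTheta_eq_of_right_eq_one p _ _ (SemidirectProduct.right_inl _) (SemidirectProduct.right_inl _) ?_
  rw [mem_closure_commutator₃_iff_forall_hHat]
  intro N
  rw [SemidirectProduct.left_inl, SemidirectProduct.left_inl]
  simp only [map_mul, map_inv]
  change levelHom N (centreRep (((g : PiTpχ p) * (h : PiTpχ p)).left)) *
      (levelHom N (centreRep (g : PiTpχ p).left) *
        levelHom N (centreRep (actχ p (g : PiTpχ p).right (h : PiTpχ p).left)))⁻¹ = 1
  rw [levelHom_centreRep N hA, levelHom_centreRep N hg, levelHom_centreRep N hθh, SemidirectProduct.mul_left, map_mul,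
    (chiTwistData p).hlev, chiTwistData_δ, Heis.diagTwist_apply]
  ext <;> simp [levelHom_x_eq_zero hg]

/-- **The étale theta cocycle of the χ-model** as an element of the continuous cocycles
`Z¹(Π^tp_Y, Δ_Θ)` (conjugation action through `Π^tp_X ↠ (Π^tp_X)^Θ`). [cite: MochizukiEtTh2009, Prop 1.3 p.20] -/
def thetaCocycleχ :
    contCocycles (ThetaSetting.modelχ p).toTheta (ThetaSetting.modelχ p).DeltaTheta (ThetaSetting.modelχ p).GtpY :=
  ⟨thetaCocycleFunχ p, continuous_thetaCocycleFunχ p, thetaCocycleFunχ_mul p⟩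

/-- [cite: MochizukiEtTh2009, Prop 1.3 p.20] -/
@[simp] theorem coe_thetaCocycleχ : (thetaCocycleχ p).1 = thetaCocycleFunχ p := rfl

/-! ### On the `Δ_Θ`-part the cocycle is the identity (Prop. 1.3) -/

variable {p} in
/-- If all `y`-levels of `x ∈ F̂₂` vanish then `ê_b x = 1`. [cite: MochizukiEtTh2009, §1 p.13] -/
theorem eHatB_eq_one_of_forall_y_eq_zero {x : F₂hatT} (h : ∀ N : ℕ+, (hHat N x).y = 0) : eHatB x = 1 :=
  ext_of_modN fun N => by
    rw [map_one]
    exact (hHat_y_eq_zero_iff N x).mp (h N)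

/-- **Prop. 1.3 at the model — the cocycle restricted to the `Δ_Θ`-part IS the identity**: for `g ∈ Π^tp_Y` lying in
`Ker(Π^tp_X ↠ (Π^tp_X)^ell)` (so `toTheta g ∈ Δ_Θ`), `thetaCocycleFunχ g = toTheta g` ("the restriction of `η^Θ` to the
geometric part is the natural isomorphism `Δ_Θ ⊗ ℤ/N`", `e = 1`). [cite: MochizukiEtTh2009, Prop 1.3 p.20] -/
theorem thetaCocycleFunχ_eq_of_mem_ellKer (g : ↥(ThetaSetting.modelχ p).GtpY)
    (hg : (g : PiTpχ p) ∈ CurveTheta.ellKer (curveχ p)) :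
    ((thetaCocycleFunχ p g : ↥(ThetaSetting.modelχ p).DeltaTheta) : CurveTheta.GTheta (curveχ p)) =
      CurveTheta.toTheta (curveχ p) (g : PiTpχ p) := by
  obtain ⟨hxy, hright⟩ := (mem_ellKerχ_iff p _).mp hg
  have hy : eHatB (gfpFst (g : PiTpχ p).left) = 1 := eHatB_eq_one_of_forall_y_eq_zero fun N => (hxy N).2
  rw [coe_thetaCocycleFunχ, centreRep, hy, map_one, inv_one, mul_one, ← eq_inl_of_right_eq_one hright]

/-! ### The classes `η^Θ ∈ H¹(Π^tp_Y, Δ_Θ)`, `η̈^Θ ∈ H¹(Π^tp_Ÿ, Δ_Θ)` of the model -/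

/-- **`η^Θ` of the χ-model**: the class of the theta cocycle in `H¹(Π^tp_Y, Δ_Θ)`. [cite: MochizukiEtTh2009, Prop 1.3 p.20] -/
def etaχ : (ThetaSetting.modelχ p).H1 (ThetaSetting.modelχ p).GtpY :=
  ContH1.mk (thetaCocycleFunχ p) (thetaCocycleχ p).2

/-- **`η̈^Θ` of the χ-model**: the restriction of `η^Θ` to `Π^tp_Ÿ` ("`η̈^Θ ∈ H¹(Π^tp_Ÿ, Δ_Θ)`", p. 21).
[cite: MochizukiEtTh2009, Prop 1.3 p.21] -/
def etaDdχ : (ThetaSetting.modelχ p).H1 (ThetaSetting.modelχ p).GtpYdd :=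
  ContH1.res (ThetaSetting.modelχ p).toTheta (ThetaSetting.modelχ p).DeltaTheta (ThetaSetting.modelχ p).GtpYdd_le_GtpY
    (etaχ p)

/-- `η̈^Θ` is represented by the restricted cocycle. [cite: MochizukiEtTh2009, Prop 1.3 p.21] -/
theorem etaDdχ_eq_mk : etaDdχ p =
    ContH1.mk (fun g : ↥(ThetaSetting.modelχ p).GtpYdd =>
        thetaCocycleFunχ p ⟨g, (ThetaSetting.modelχ p).GtpYdd_le_GtpY g.2⟩)
      (ContH1.resCocycle (ThetaSetting.modelχ p).toTheta (ThetaSetting.modelχ p).DeltaTheta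
        (ThetaSetting.modelχ p).GtpYdd_le_GtpY (thetaCocycleχ p)).2 :=
  rfl

/-- `inl(c^t) ∈ Π^tp_Ÿ` (`= Π^tp_{Y₂}`: levels `(0, 0, t mod 2)` lie in the `z`-axis). [cite: MochizukiEtTh2009, §1 p.17] -/
theorem inl_cGfpχ_mem_GtpYdd (t : ZH) :
    (SemidirectProduct.inl (cGfpχ t) : PiTpχ p) ∈ (ThetaSetting.modelχ p).GtpYdd := by
  rw [GtpYdd_modelχ]
  refine (GfpTwistData.mem_YN _).mpr ⟨?_, by rw [SemidirectProduct.right_inl]; exact Subgroup.one_mem _⟩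
  rw [SemidirectProduct.left_inl]
  refine Subgroup.mem_inf.mpr ⟨rfl, Subgroup.mem_comap.mpr ?_⟩
  change hHat 2 (gfpFst (cGfpχ t)) ∈ Heis.zAxis
  rw [gfpFst_cGfpχ, hHat_apply_of_cPowSpec _ powHat_commutator_spec]
  exact ⟨rfl, rfl⟩

/-- **`η̈^Θ` of the χ-model is NOT the trivial class**: a coboundary vanishes at every `h` with `toTheta h ∈ Δ_Θ`
(`Δ_Θ` is commutative), whereas the theta cocycle is the identity there; evaluate at `inl(c)`, `c = ⁅a,b⁆`.
[cite: MochizukiEtTh2009, Prop 1.3 p.21] -/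
theorem etaDdχ_ne_one : etaDdχ p ≠ 1 := by
  intro h
  rw [etaDdχ_eq_mk, ContH1.mk_eq_one_iff, mem_contCoboundaries_iff] at h
  obtain ⟨a, ha⟩ := h
  -- evaluate at `h₀ := inl (c^{ι 1}) ∈ Π^tp_Ÿ`
  have hmem := inl_cGfpχ_mem_GtpYdd p (iotaZ (Multiplicative.ofAdd 1))
  have key := congrFun ha ⟨_, hmem⟩
  dsimp only at key
  -- the coboundary value vanishes: `toTheta (inl c^t) ∈ Δ_Θ` commutes with `a ∈ Δ_Θ`
  have hc : (ThetaSetting.modelχ p).toTheta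
      (SemidirectProduct.inl (cGfpχ (iotaZ (Multiplicative.ofAdd 1))) : PiTpχ p) ∈
        (ThetaSetting.modelχ p).DeltaTheta :=
    cThetaχ_mem_ker p _
  have hcomm : MulAut.conjNormal ((ThetaSetting.modelχ p).toTheta
      (SemidirectProduct.inl (cGfpχ (iotaZ (Multiplicative.ofAdd 1))) : PiTpχ p)) a = a := by
    apply Subtype.ext
    rw [MulAut.conjNormal_apply, (ThetaSetting.modelχ p).ker_thetaToEll_comm _ hc _ a.2, mul_inv_cancel_right]
  rw [hcomm, mul_inv_cancel] at key
  -- but the cocycle value is `toTheta (inl c^t) = c^t ≠ 1`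
  have hE : (SemidirectProduct.inl (cGfpχ (iotaZ (Multiplicative.ofAdd 1))) : PiTpχ p) ∈
      CurveTheta.ellKer (curveχ p) :=
    (CurveTheta.mk_mem_ker_thetaToEll_iff _ _).mp hc
  have hval : ((thetaCocycleFunχ p ⟨_, (ThetaSetting.modelχ p).GtpYdd_le_GtpY hmem⟩ :
      ↥(ThetaSetting.modelχ p).DeltaTheta) : CurveTheta.GTheta (curveχ p)) =
        cThetaχ p (iotaZ (Multiplicative.ofAdd 1)) := by
    rw [thetaCocycleFunχ_eq_of_mem_ellKer p _ hE]
    rfl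
  have h1 : cThetaχ p (iotaZ (Multiplicative.ofAdd 1)) = 1 := by
    rw [← hval]
    exact congrArg Subtype.val key
  have ht1 : iotaZ (Multiplicative.ofAdd (1 : ℤ)) = 1 :=
    cThetaχ_injective p (h1.trans (map_one (cThetaχ p)).symm)
  have h01 : Multiplicative.ofAdd (1 : ℤ) = Multiplicative.ofAdd 0 :=
    iotaZ_injective (ht1.trans (by rw [ofAdd_zero, iotaZ.map_one]))
  exact one_ne_zero (Multiplicative.ofAdd.injective h01)

/-- `η^Θ` of the χ-model is not the trivial class either. [cite: MochizukiEtTh2009, Prop 1.3 p.20] -/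
theorem etaχ_ne_one : etaχ p ≠ 1 := fun h => etaDdχ_ne_one p (by rw [etaDdχ, h, map_one])

/-! ### The choice `X̲̲` for the model's étale-theta datum: `eta_res` and `DoubleUnderline` -/

/-- **On `Π^tp_Ÿ ∩ Π^tp_X̲̲` the theta cocycle is `l·Δ_Θ`-valued** (`X̲̲ := Huuχ p l`): for `g ∈ Π^tp_Y ∩ Huuχ`,
`centreRep g.left ∈ dUU l` (levels at `l`: `(0, 0, z_l) = (0, 0, 0)`), so the value lies in
`θ(Π^tp_X̲̲) ∩ Δ_Θ = l·Δ_Θ`. [cite: MochizukiEtTh2009, Def 2.7 p.41] -/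
theorem thetaCocycleFunχ_mem_lDeltaTheta_of_mem_Huuχ (l : ℕ+) (g : ↥(ThetaSetting.modelχ p).GtpY)
    (hg : (g : PiTpχ p) ∈ Huuχ p l) :
    ((thetaCocycleFunχ p g : ↥(ThetaSetting.modelχ p).DeltaTheta) : CurveTheta.GTheta (curveχ p)) ∈
      (ThetaSetting.modelχ p).lDeltaTheta l := by
  rw [← map_toTheta_Huuχ_modelχ]
  refine Subgroup.mem_inf.mpr ⟨⟨SemidirectProduct.inl (centreRep (g : PiTpχ p).left), ?_, rfl⟩,
    (thetaCocycleFunχ p g).2⟩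
  obtain ⟨-, hz⟩ := (mem_Huuχ_iff p l _).mp hg
  rw [SetLike.mem_coe, inl_mem_Huuχ_iff, mem_dUU_iff, levelHom_centreRep l (left_mem_ker_of_mem_GtpY g.2)]
  exact ⟨rfl, hz⟩

/-- **`eta_res` for the model's own theta class**: on `Π^tp_Ÿ ∩ Π^tp_X̲̲` the class `η̈^Θ|` is represented by an
`l·Δ_Θ`-valued continuous cocycle — the restriction of the theta cocycle itself. [cite: MochizukiEtTh2009, Def 2.7 p.41] -/
theorem eta_res_thetaCocycleχ (l : ℕ+) :
    ∃ (f : ↥((ThetaSetting.modelχ p).GtpYdd ⊓ Huuχ p l) → (ThetaSetting.modelχ p).DeltaTheta)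
      (hf : f ∈ contCocycles (ThetaSetting.modelχ p).toTheta (ThetaSetting.modelχ p).DeltaTheta
        ((ThetaSetting.modelχ p).GtpYdd ⊓ Huuχ p l)),
      (∀ g, (f g : (ThetaSetting.modelχ p).GtpTheta) ∈ (ThetaSetting.modelχ p).lDeltaTheta l) ∧
        ContH1.mk f hf =
          ContH1.res (ThetaSetting.modelχ p).toTheta (ThetaSetting.modelχ p).DeltaTheta inf_le_left (etaDdχ p) := by
  have hle : (ThetaSetting.modelχ p).GtpYdd ⊓ Huuχ p l ≤ (ThetaSetting.modelχ p).GtpY :=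
    inf_le_left.trans (ThetaSetting.modelχ p).GtpYdd_le_GtpY
  refine ⟨_, (ContH1.resCocycle (ThetaSetting.modelχ p).toTheta (ThetaSetting.modelχ p).DeltaTheta hle
      (thetaCocycleχ p)).2, fun g => ?_, ?_⟩
  · exact thetaCocycleFunχ_mem_lDeltaTheta_of_mem_Huuχ p l ⟨g, hle g.2⟩ (Subgroup.mem_inf.mp g.2).2
  · rw [etaDdχ, etaχ, ContH1.res_res]
    rfl

/-- **The choice `X̲̲` (Def. 2.5 (i) / Def. 2.7) INHABITED at the χ-model for the étale-theta datum carrying the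
model's theta class `η̈^Θ`**: `Π^tp_X̲̲ := Huuχ p l`, all six printed properties proved (`eta_res` by
`eta_res_thetaCocycleχ`, the rest by hand #2′). [cite: MochizukiEtTh2009, Def 2.7 p.41] -/
def doubleUnderlineχ (l : ℕ+) (hl : Odd (l : ℕ)) :
    ((kummerDataχ p).etaleThetaDataOfClass (etaDdχ p)).DoubleUnderline l :=
  ThetaSetting.EtaleThetaData.doubleUnderlineχOfEtaRes p l hl _ (eta_res_thetaCocycleχ p l)

/-- [cite: MochizukiEtTh2009, Def 2.7 p.41] -/
theorem doubleUnderlineχ_Huu (l : ℕ+) (hl : Odd (l : ℕ)) : (doubleUnderlineχ p l hl).Huu = Huuχ p l := rfl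

/-- **NV token**: at the χ-model there is an étale-theta datum with NON-TRIVIAL class `η̈^Θ` admitting the choice `X̲̲`
for every odd `l`. [cite: MochizukiEtTh2009, Def 2.7 p.41] -/
theorem exists_etaleThetaData_ne_one_and_doubleUnderline :
    ∃ E : (ThetaSetting.modelχ p).EtaleThetaData, E.etaDd ≠ 1 ∧ ∀ l : ℕ+, Odd (l : ℕ) → Nonempty (E.DoubleUnderline l) :=
  ⟨(kummerDataχ p).etaleThetaDataOfClass (etaDdχ p), etaDdχ_ne_one p, fun l hl => ⟨doubleUnderlineχ p l hl⟩⟩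

end Literature.AnabelianGeometry.EtaleTheta.SettingModel

end
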